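import Literature.AlgebraicGeometry.Motives.CorrespondencesKunneth
import Literature.AlgebraicGeometry.Motives.CorrespondencesCompProofs
import Literature.AlgebraicGeometry.Motives.WeilCohomologyProofs
import Literature.AlgebraicGeometry.Motives.VarietiesProjectiveSpaceProofs
import HarnessLib

/-!
# Calculus of algebraic operators on a Weil cohomology theory

For a Weil cohomology theory `W : WeilCohomology k K` this file develops the elementary closure
properties of the prelude's predicate `W.IsAlgebraicOperator nX nY T` ("the linear map
`T : Hⁱ(X) → Hʲ(Y)`, extended by zero to a graded operator, is induced by algebraic
correspondences with `ℚ`-coefficients", Kleiman, *Algebraic cycles and the Weil conjectures*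
(1968) §1.3–1.4; Kleiman, *The standard conjectures* (1994) §4) that the proofs of the relations
among the standard conjectures use:

* `ℚ`-linear combinations of algebraic operators are algebraic (`IsAlgebraicOperator.add`,
  `.ratCast_smul`, `.sum`, …; the classes `A(X × Y)_ℚ` form a divisible subgroup);
* **twisting by an algebraic class**: if `T : Hⁱ(X) → Hʲ(Y)` is algebraic and `ζ ∈ Aʳ(X)_ℚ`, then
  `x ↦ T (x ∪ ζ)` is algebraic, induced by `pr₁* ζ ∪ u` (`IsAlgebraicOperator.comp_cup`); in
  particular composition with the iterated Lefschetz operator of a hyperplane class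
  (`IsAlgebraicOperator.comp_lefschetzPow`), hyperplane classes and their powers being rational
  algebraic classes (`pow_mem_ratAlgebraicClasses_of_isHyperplaneClass`, via
  `isSmoothProjective_projectiveSpace_holds`; cf. `MotivatedCyclesProofs`);
* consequently an algebraic `θ` inverse to `Lⁿ⁻ⁱ` makes `id : Hⁱ(X) → Hⁱ(X)` algebraic
  (`isAlgebraicOperator_id_of_isLefschetzTheta`, the Künneth projector `πⁱ`, `i ≤ n`, from
  `B(X)` — Kleiman 1968 §2 / Kleiman 1994 §4, the direction `B ⇒ C` in degrees `≤ n`);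
* composition and powers of single-component algebraic operators (`IsAlgebraicOperator.comp`,
  `.pow`), from the discharged fact `isAlgebraicGradedOp_comp_holds` (`CorrespondencesCompProofs`)
  via `GradedOp.comp (ofLinearMap S) (ofLinearMap T) = ofLinearMap (S ∘ T)`.

Everything is a theorem with a real proof; no new definitions.

## References

* S. Kleiman, *Algebraic cycles and the Weil conjectures* (1968), §1.3, §1.4, §2.
* S. Kleiman, *The standard conjectures* (1994), §4.
-/

universe u v

open CategoryTheory AlgebraicGeometry MonoidalCategory CartesianMonoidalCategory Opposite
open scoped TensorProduct

noncomputable section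

namespace Literature.AlgebraicGeometry.Motives

/-! ## Graded operators with one component -/

namespace PreWeilCohomology

namespace GradedOp

variable {k : Type u} [Field k] {K : Type v} [Field K] {W : PreWeilCohomology k K}
variable {X Y Z : SchemeOver k} {i j l : ℕ}

/-- `ofLinearMap` is additive. [folklore] -/
theorem ofLinearMap_add (T T' : W.obj X i →ₗ[K] W.obj Y j) :
    ofLinearMap (T + T') = ofLinearMap T + ofLinearMap T' := by
  funext a b
  by_cases h : i = a ∧ j = b
  · obtain ⟨rfl, rfl⟩ := h
    simp [ofLinearMap_apply_same]
  · simp [ofLinearMap_apply_of_ne _ h]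

/-- `ofLinearMap` commutes with scalars. [folklore] -/
theorem ofLinearMap_smul (c : K) (T : W.obj X i →ₗ[K] W.obj Y j) :
    ofLinearMap (c • T) = c • ofLinearMap T := by
  funext a b
  by_cases h : i = a ∧ j = b
  · obtain ⟨rfl, rfl⟩ := h
    simp [ofLinearMap_apply_same]
  · simp [ofLinearMap_apply_of_ne _ h]

/-- `ofLinearMap 0 = 0`. [folklore] -/
@[simp]
theorem ofLinearMap_zero : ofLinearMap (0 : W.obj X i →ₗ[K] W.obj Y j) = 0 := by
  funext a b
  by_cases h : i = a ∧ j = b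
  · obtain ⟨rfl, rfl⟩ := h
    simp [ofLinearMap_apply_same]
  · simp [ofLinearMap_apply_of_ne _ h]

/-- Composition of two one-component graded operators in matching degrees is the one-component
operator of the composite: `(S) ∘ (T) = (S ∘ T)` (the `finsum` over the middle degree has one
nonzero term). [folklore] -/
theorem comp_ofLinearMap_ofLinearMap (S : W.obj Y j →ₗ[K] W.obj Z l)
    (T : W.obj X i →ₗ[K] W.obj Y j) :
    (ofLinearMap S).comp (ofLinearMap T) = ofLinearMap (S ∘ₗ T) := by
  funext a b
  rw [comp, finsum_eq_single _ j fun m hm ↦ by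
    rw [ofLinearMap_apply_of_ne T fun h ↦ hm h.2.symm, LinearMap.comp_zero]]
  by_cases h : i = a ∧ l = b
  · obtain ⟨rfl, rfl⟩ := h
    simp [ofLinearMap_apply_same]
  · rw [ofLinearMap_apply_of_ne _ h]
    by_cases ha : i = a
    · subst ha
      rw [ofLinearMap_apply_of_ne S fun h' ↦ h ⟨rfl, h'.2⟩, LinearMap.zero_comp]
    · rw [ofLinearMap_apply_of_ne T fun h' ↦ ha h'.1, LinearMap.comp_zero]

end GradedOp

/-! ## Additivity of `IsInducedBy` -/

variable {k : Type u} [Field k] {K : Type v} [Field K] (W : PreWeilCohomology k K)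
variable {X Y : SchemeOver k} {nX nY m i j j' : ℕ} {hj : j + j' = 2 * nY}
  {hm : i + m + j' = 2 * (nX + nY)}

/-- The zero correspondence induces the zero map. [folklore] -/
theorem isInducedBy_zero : W.IsInducedBy nX nY (0 : W.obj (X ⊗ Y) m)
    (0 : W.obj X i →ₗ[K] W.obj Y j) hj hm := by
  intro x y
  simp

variable {W}

/-- `IsInducedBy` is additive in the pair (correspondence, map). [folklore] -/
theorem IsInducedBy.add {u v : W.obj (X ⊗ Y) m} {T S : W.obj X i →ₗ[K] W.obj Y j}
    (hu : W.IsInducedBy nX nY u T hj hm) (hv : W.IsInducedBy nX nY v S hj hm) :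
    W.IsInducedBy nX nY (u + v) (T + S) hj hm := by
  intro x y
  simp only [LinearMap.add_apply, map_add, hu x y, hv x y]

/-- `IsInducedBy` is homogeneous in the pair (correspondence, map). [folklore] -/
theorem IsInducedBy.smul {u : W.obj (X ⊗ Y) m} {T : W.obj X i →ₗ[K] W.obj Y j}
    (hu : W.IsInducedBy nX nY u T hj hm) (c : K) :
    W.IsInducedBy nX nY (c • u) (c • T) hj hm := by
  intro x y
  simp only [LinearMap.smul_apply, map_smul, hu x y]

end PreWeilCohomology

namespace WeilCohomology

variable {k : Type u} [Field k] {K : Type v} [Field K] [CharZero K] (W : WeilCohomology k K)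

/-! ## Rational multiples of rational algebraic classes -/

section RatSmul

variable {X : SchemeOver k} {p : ℕ}

/-- `A^p(X)_ℚ` is a `ℚ`-subspace: `q • x ∈ A^p(X)_ℚ` for `x ∈ A^p(X)_ℚ` and `q ∈ ℚ` (it is the
divisible hull of the lattice `Aᵖ(X)`). [folklore] -/
theorem ratCast_smul_mem_ratAlgebraicClasses {x : W.obj X (2 * p)}
    (hx : x ∈ W.ratAlgebraicClasses X p) (q : ℚ) : (q : K) • x ∈ W.ratAlgebraicClasses X p := by
  obtain ⟨N, hN, hNx⟩ := hx
  refine ⟨N * q.den, mul_ne_zero hN (by exact_mod_cast q.den_ne_zero), ?_⟩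
  have : ((N * q.den : ℤ)) • ((q : K) • x) = q.num • (N • x) := by
    rw [← Int.cast_smul_eq_zsmul K, ← Int.cast_smul_eq_zsmul K q.num, ← Int.cast_smul_eq_zsmul K N,
      smul_smul, smul_smul]
    congr 1
    push_cast
    rw [mul_assoc, ← Rat.cast_natCast, ← Rat.cast_mul, Rat.den_mul_eq_num, Rat.cast_intCast]
    ring
  rw [this]
  exact AddSubgroup.zsmul_mem _ hNx _

end RatSmul

/-! ## Linear combinations of algebraic operators -/

section Linear

variable {X Y : SchemeOver k} {nX nY i j : ℕ}

/-- The zero operator is algebraic. [folklore] -/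
theorem isAlgebraicOperator_zero :
    W.IsAlgebraicOperator nX nY (0 : W.obj X i →ₗ[K] W.obj Y j) := by
  refine ⟨fun _ ↦ 0, fun a b c b' hb hm _ ↦ ?_, fun a b _ ↦ ?_⟩
  · rw [PreWeilCohomology.GradedOp.ofLinearMap_zero]
    exact W.isInducedBy_zero
  · rw [PreWeilCohomology.GradedOp.ofLinearMap_zero]
    rfl

variable {W}

/-- Sums of algebraic operators (in the same bidegree) are algebraic. [folklore] -/
theorem _root_.Literature.AlgebraicGeometry.Motives.PreWeilCohomology.IsAlgebraicOperator.add
    {T T' : W.obj X i →ₗ[K] W.obj Y j}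
    (hT : W.IsAlgebraicOperator nX nY T) (hT' : W.IsAlgebraicOperator nX nY T') :
    W.IsAlgebraicOperator nX nY (T + T') := by
  obtain ⟨u, hu, hu0⟩ := hT
  obtain ⟨v, hv, hv0⟩ := hT'
  refine ⟨fun c ↦ u c + v c, fun a b c b' hb hm hc ↦ ?_, fun a b hab ↦ ?_⟩
  · rw [PreWeilCohomology.GradedOp.ofLinearMap_add, AddSubgroup.coe_add]
    exact (hu a b c b' hb hm hc).add (hv a b c b' hb hm hc)
  · rw [PreWeilCohomology.GradedOp.ofLinearMap_add, Pi.add_apply, Pi.add_apply, hu0 a b hab,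
      hv0 a b hab, add_zero]

/-- Rational multiples of algebraic operators are algebraic. [folklore] -/
theorem _root_.Literature.AlgebraicGeometry.Motives.PreWeilCohomology.IsAlgebraicOperator.ratCast_smul
    {T : W.obj X i →ₗ[K] W.obj Y j}
    (hT : W.IsAlgebraicOperator nX nY T) (q : ℚ) :
    W.IsAlgebraicOperator nX nY ((q : K) • T) := by
  obtain ⟨u, hu, hu0⟩ := hT
  refine ⟨fun c ↦ ⟨(q : K) • (u c : W.obj (X ⊗ Y) (2 * c)),
    W.ratCast_smul_mem_ratAlgebraicClasses (u c).2 q⟩, fun a b c b' hb hm hc ↦ ?_, fun a b hab ↦ ?_⟩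
  · rw [PreWeilCohomology.GradedOp.ofLinearMap_smul]
    exact (hu a b c b' hb hm hc).smul (q : K)
  · rw [PreWeilCohomology.GradedOp.ofLinearMap_smul, Pi.smul_apply, Pi.smul_apply, hu0 a b hab,
      smul_zero]

/-- Negatives of algebraic operators are algebraic. [folklore] -/
theorem _root_.Literature.AlgebraicGeometry.Motives.PreWeilCohomology.IsAlgebraicOperator.neg
    {T : W.obj X i →ₗ[K] W.obj Y j}
    (hT : W.IsAlgebraicOperator nX nY T) : W.IsAlgebraicOperator nX nY (-T) := by
  simpa using hT.ratCast_smul (-1)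

/-- Differences of algebraic operators are algebraic. [folklore] -/
theorem _root_.Literature.AlgebraicGeometry.Motives.PreWeilCohomology.IsAlgebraicOperator.sub
    {T T' : W.obj X i →ₗ[K] W.obj Y j}
    (hT : W.IsAlgebraicOperator nX nY T) (hT' : W.IsAlgebraicOperator nX nY T') :
    W.IsAlgebraicOperator nX nY (T - T') := by
  simpa [sub_eq_add_neg] using hT.add hT'.neg

/-- Finite sums of algebraic operators are algebraic. [folklore] -/
theorem _root_.Literature.AlgebraicGeometry.Motives.PreWeilCohomology.IsAlgebraicOperator.sum
    {ι : Type*} (s : Finset ι) {T : ι → (W.obj X i →ₗ[K] W.obj Y j)}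
    (hT : ∀ m ∈ s, W.IsAlgebraicOperator nX nY (T m)) :
    W.IsAlgebraicOperator nX nY (∑ m ∈ s, T m) := by
  classical
  induction s using Finset.induction_on with
  | empty => simpa using W.isAlgebraicOperator_zero
  | insert a s ha ih =>
    rw [Finset.sum_insert ha]
    exact (hT a (Finset.mem_insert_self a s)).add (ih fun m hm ↦ hT m (Finset.mem_insert_of_mem hm))

/-- Rational linear combinations of algebraic operators are algebraic. [folklore] -/
theorem _root_.Literature.AlgebraicGeometry.Motives.PreWeilCohomology.IsAlgebraicOperator.sum_ratCast_smul
    {ι : Type*} (s : Finset ι) (q : ι → ℚ)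
    {T : ι → (W.obj X i →ₗ[K] W.obj Y j)} (hT : ∀ m ∈ s, W.IsAlgebraicOperator nX nY (T m)) :
    W.IsAlgebraicOperator nX nY (∑ m ∈ s, ((q m : ℚ) : K) • T m) :=
  PreWeilCohomology.IsAlgebraicOperator.sum s fun m hm ↦ (hT m hm).ratCast_smul (q m)

/-- If an operator has no admissible correspondence degree, algebraicity forces it to vanish. [folklore] -/
theorem _root_.Literature.AlgebraicGeometry.Motives.PreWeilCohomology.IsAlgebraicOperator.eq_zero_of_not_exists
    {T : W.obj X i →ₗ[K] W.obj Y j}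
    (hT : W.IsAlgebraicOperator nX nY T) (h : ¬ ∃ c, 2 * c + i = j + 2 * nX) : T = 0 := by
  obtain ⟨u, -, hu0⟩ := hT
  have := hu0 i j h
  rwa [PreWeilCohomology.GradedOp.ofLinearMap_apply_same] at this

end Linear

/-! ## Twisting an algebraic operator by an algebraic class -/

section Twist

variable {X Y : SchemeOver k} {nX nY i j : ℕ}
variable {W}

/-- **Twist by an algebraic class.** If `T : Hⁱ(X) → Hʲ(Y)` is algebraic (`X`, `Y` smooth
projective of dimensions `nX`, `nY`) and `ζ ∈ Aʳ(X)_ℚ`, then `x ↦ T (x ∪ ζ) : Hᵃ(X) → Hʲ(Y)`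
(`a + 2r = i`) is algebraic: if `u ∈ A^c(X × Y)_ℚ` induces `T`, then `pr₁* ζ ∪ u ∈ A^{c+r}(X × Y)_ℚ`
induces the twist (Kleiman 1968 §1.3: `u ∘ (· ∪ ζ)` is the correspondence `pr₁* ζ · u`).
Depends only on: `IsSmoothProjective.tensor_holds`, `cup_assoc`, `map_cup`,
`pullback_ratAlgebraicClasses_le`, `cup_mem_ratAlgebraicClasses`. [cite: Kleiman1968AlgebraicCycles, §1.3] -/
theorem _root_.Literature.AlgebraicGeometry.Motives.PreWeilCohomology.IsAlgebraicOperator.comp_cup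
    (hX : IsSmoothProjective nX X) (hY : IsSmoothProjective nY Y) {T : W.obj X i →ₗ[K] W.obj Y j}
    (hT : W.IsAlgebraicOperator nX nY T) {r a : ℕ} {ζ : W.obj X (2 * r)}
    (hζ : ζ ∈ W.ratAlgebraicClasses X r) (h : a + 2 * r = i) :
    W.IsAlgebraicOperator nX nY (T ∘ₗ (W.cup h).flip ζ) := by
  classical
  by_cases hex : ∃ c, 2 * c + i = j + 2 * nX
  swap
  · rw [hT.eq_zero_of_not_exists hex, LinearMap.zero_comp]
    exact W.isAlgebraicOperator_zero
  obtain ⟨c₀, hc₀⟩ := hex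
  obtain ⟨u, hu, hu0⟩ := hT
  have hXY := isSmoothProjective_tensor hX hY
  have hζ' : W.pullback (fst X Y) (2 * r) ζ ∈ W.ratAlgebraicClasses (X ⊗ Y) r :=
    W.pullback_ratAlgebraicClasses_le hXY hX (fst X Y) r ⟨ζ, hζ, rfl⟩
  -- the twisted operator, extended by zero, agrees with `x ↦ (T extended by zero) (x ∪ ζ)`
  have htw : ∀ (a' b : ℕ) (h' : a' + 2 * r = a' + 2 * r) (x : W.obj X a'),
      PreWeilCohomology.GradedOp.ofLinearMap (T ∘ₗ (W.cup h).flip ζ) a' b x =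
        PreWeilCohomology.GradedOp.ofLinearMap T (a' + 2 * r) b (W.cup h' x ζ) := by
    intro a' b h' x
    by_cases hab : a = a' ∧ j = b
    · obtain ⟨rfl, rfl⟩ := hab
      subst h
      rw [PreWeilCohomology.GradedOp.ofLinearMap_apply_same,
        PreWeilCohomology.GradedOp.ofLinearMap_apply_same]
      rfl
    · rw [PreWeilCohomology.GradedOp.ofLinearMap_apply_of_ne _ hab,
        PreWeilCohomology.GradedOp.ofLinearMap_apply_of_ne _ fun h'' ↦ hab ⟨by omega, h''.2⟩,
        LinearMap.zero_apply, LinearMap.zero_apply]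
  let w : ↥(W.ratAlgebraicClasses (X ⊗ Y) (c₀ + r)) :=
    ⟨W.cup (by omega : 2 * r + 2 * c₀ = 2 * (c₀ + r)) (W.pullback (fst X Y) (2 * r) ζ)
      (u c₀ : W.obj (X ⊗ Y) (2 * c₀)),
      W.cup_mem_ratAlgebraicClasses hXY (by omega : r + c₀ = c₀ + r) _ _ hζ' (u c₀).2⟩
  refine ⟨Function.update (fun _ ↦ 0) (c₀ + r) w, fun a' b c b' hb hm hc ↦ ?_, fun a' b hab ↦ ?_⟩
  · by_cases hcc : c = c₀ + r
    · subst hcc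
      rw [Function.update_self]
      intro x y
      -- reassociate `(x ∪ (ζ ∪ u)) ∪ y = ((x ∪ ζ) ∪ u) ∪ y` through the right-nested form
      have e₁ : 2 * (c₀ + r) + b' = 2 * (c₀ + r) + b' := rfl
      have e₂ : a' + (2 * (c₀ + r) + b') = 2 * (nX + nY) := by omega
      have e₃ : 2 * c₀ + b' = 2 * c₀ + b' := rfl
      have e₄ : 2 * r + (2 * c₀ + b') = 2 * (c₀ + r) + b' := by omega
      have e₅ : a' + 2 * r + (2 * c₀ + b') = 2 * (nX + nY) := by omega
      have hm' : a' + 2 * r + 2 * c₀ + b' = 2 * (nX + nY) := by omega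
      rw [htw a' b rfl x, W.cup_assoc hXY rfl e₁ hm e₂,
        W.cup_assoc hXY (by omega : 2 * r + 2 * c₀ = 2 * (c₀ + r)) e₃ e₁ e₄,
        ← W.cup_assoc hXY (rfl : a' + 2 * r = a' + 2 * r) e₄ e₅ e₂,
        ← W.map_cup hXY hX (fst X Y),
        ← W.cup_assoc hXY (rfl : a' + 2 * r + 2 * c₀ = a' + 2 * r + 2 * c₀) e₃ hm' e₅]
      exact hu (a' + 2 * r) b c₀ b' hb hm' (by omega) (W.cup rfl x ζ) y
    · rw [Function.update_of_ne hcc, AddSubgroup.coe_zero]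
      have h0 : PreWeilCohomology.GradedOp.ofLinearMap (T ∘ₗ (W.cup h).flip ζ) a' b = 0 :=
        PreWeilCohomology.GradedOp.ofLinearMap_apply_of_ne _ fun hab ↦ hcc (by omega)
      rw [h0]
      exact W.isInducedBy_zero
  · exact PreWeilCohomology.GradedOp.ofLinearMap_apply_of_ne _ fun h' ↦ hab ⟨c₀ + r, by omega⟩

end Twist

/-! ## Hyperplane classes and Lefschetz operators are algebraic -/

section Lefschetz

variable {n : ℕ} {X : SchemeOver k} {η : W.obj X 2}

/-- A hyperplane class `η = ι* cl(D)` (`ι : X ↪ ℙᴺ` a closed immersion, `D` a codimension-`1`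
cycle on `ℙᴺ`) is a rational algebraic class: `ℙᴺ` is smooth projective
(`isSmoothProjective_projectiveSpace_holds`), `cl(D) ∈ A¹(ℙᴺ)` (`cycleMap_mem_algebraicLattice`) and
pull-backs preserve rational algebraic classes (`pullback_ratAlgebraicClasses_le`). Private copy of
`WeilCohomology.mem_ratAlgebraicClasses_of_isHyperplaneClass` (`MotivatedCyclesProofs`), kept local
to avoid that import. [cite: Kleiman1968AlgebraicCycles, §1.4] -/
private theorem mem_ratAlgebraicClasses_of_isHyperplaneClass' (hX : IsSmoothProjective n X)
    (hη : W.IsHyperplaneClass X η) : η ∈ W.ratAlgebraicClasses X 1 := by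
  obtain ⟨e, D, hD, -, rfl⟩ := hη
  exact W.pullback_ratAlgebraicClasses_le hX (isSmoothProjective_projectiveSpace_holds k e.n) e.ι 1
    ⟨_, W.algebraicLattice_le_ratAlgebraicClasses _ 1 (W.cycleMap_mem_algebraicLattice _ 1 hD), rfl⟩

/-- **Powers of a hyperplane class are rational algebraic**: `ηʳ ∈ Aʳ(X)_ℚ` for `1 ≤ r`
(Kleiman 1968 §1.4; `cup_mem_ratAlgebraicClasses`, `η¹ = 1 ∪ η = η`). [cite: Kleiman1968AlgebraicCycles, §1.4] -/
theorem pow_mem_ratAlgebraicClasses_of_isHyperplaneClass (hX : IsSmoothProjective n X)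
    (hη : W.IsHyperplaneClass X η) {r : ℕ} (hr : 1 ≤ r) :
    W.pow X η r ∈ W.ratAlgebraicClasses X r := by
  have hη₁ := W.mem_ratAlgebraicClasses_of_isHyperplaneClass' hX hη
  induction r with
  | zero => omega
  | succ r ih =>
    rcases Nat.eq_zero_or_pos r with rfl | hr'
    · have : W.pow X η 1 = η := W.one_cup hX rfl η
      rw [this]
      exact hη₁
    · rw [PreWeilCohomology.pow_succ]
      exact W.cup_mem_ratAlgebraicClasses hX rfl _ _ (ih hr') hη₁

variable {W}

/-- **Composition with a Lefschetz operator preserves algebraicity**: if `T : Hⁱ(X) → Hʲ(Y)` is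
algebraic and `η` is a hyperplane class on `X`, then `T ∘ Lʳ : Hᵃ(X) → Hʲ(Y)` is algebraic
(`a + 2r = i`; Kleiman 1968 §1.4: `L` is induced by the algebraic cycle `Δ_* η`; here via
`IsAlgebraicOperator.comp_cup` with `ζ = ηʳ`, and `L⁰ = id`). [cite: Kleiman1968AlgebraicCycles, §1.4] -/
theorem _root_.Literature.AlgebraicGeometry.Motives.PreWeilCohomology.IsAlgebraicOperator.comp_lefschetzPow
    (hX : IsSmoothProjective n X) {nY : ℕ} {Y : SchemeOver k} (hY : IsSmoothProjective nY Y)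
    {i j : ℕ} {T : W.obj X i →ₗ[K] W.obj Y j} (hT : W.IsAlgebraicOperator n nY T)
    (hη : W.IsHyperplaneClass X η) {a r : ℕ} (h : a + 2 * r = i) :
    W.IsAlgebraicOperator n nY (T ∘ₗ W.lefschetzPow X η r a i h) := by
  rcases Nat.eq_zero_or_pos r with rfl | hr
  · obtain rfl : i = a := by omega
    have : T ∘ₗ W.lefschetzPow X η 0 i i h = T :=
      LinearMap.ext fun x ↦ congrArg T (W.lefschetzPow_zero_apply hX η h x)
    rwa [this]
  · exact hT.comp_cup hX hY (W.pow_mem_ratAlgebraicClasses_of_isHyperplaneClass hX hη hr) h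

/-- **`θ` algebraic makes `πⁱ` algebraic** (Kleiman 1968 §2, `B(X) ⇒ C(X)` in degrees `≤ n`;
Kleiman 1994 Cor. 4-2): if `θ : H²ⁿ⁻ⁱ(X) → Hⁱ(X)` is a two-sided inverse of `Lⁿ⁻ⁱ`
(`W.IsLefschetzTheta`) induced by an algebraic correspondence and `η` is a hyperplane class, then
`id = θ ∘ Lⁿ⁻ⁱ : Hⁱ(X) → Hⁱ(X)` is algebraic. [cite: Kleiman1968AlgebraicCycles, §2 (B(X) ⇒ πⁱ algebraic, i ≤ n)] -/
theorem isAlgebraicOperator_id_of_isLefschetzTheta (hX : IsSmoothProjective n X)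
    (hη : W.IsHyperplaneClass X η) {i j r : ℕ} {h : i + 2 * r = j}
    {θ : W.obj X j →ₗ[K] W.obj X i} (hθ : W.IsLefschetzTheta n η r h θ)
    (halg : W.IsAlgebraicOperator n n θ) :
    W.IsAlgebraicOperator n n (LinearMap.id : W.obj X i →ₗ[K] W.obj X i) := by
  rw [← hθ.2.1]
  exact halg.comp_lefschetzPow hX hX hη h

end Lefschetz

/-! ## Composition -/

section Comp

variable {X Y Z : SchemeOver k} {nX nY nZ i j l : ℕ}
variable {W}

/-- **Composites of one-component algebraic operators are algebraic** (Kleiman 1968 §1.3,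
`v ∘ u = p₁₃₊ (p₁₂* u ∪ p₂₃* v)`; the discharged fact `isAlgebraicGradedOp_comp_holds` of
`CorrespondencesCompProofs`): for `T : Hⁱ(X) → Hʲ(Y)` and `S : Hʲ(Y) → Hˡ(Z)` algebraic, `S ∘ T` is
algebraic (`GradedOp.comp_ofLinearMap_ofLinearMap`). [cite: Kleiman1968AlgebraicCycles, §1.3] -/
theorem _root_.Literature.AlgebraicGeometry.Motives.PreWeilCohomology.IsAlgebraicOperator.comp
    (hX : IsSmoothProjective nX X) (hY : IsSmoothProjective nY Y) (hZ : IsSmoothProjective nZ Z)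
    {S : W.obj Y j →ₗ[K] W.obj Z l} {T : W.obj X i →ₗ[K] W.obj Y j}
    (hS : W.IsAlgebraicOperator nY nZ S) (hT : W.IsAlgebraicOperator nX nY T) :
    W.IsAlgebraicOperator nX nZ (S ∘ₗ T) := by
  have := W.isAlgebraicGradedOp_comp_holds hX hY hZ hS hT
  rwa [PreWeilCohomology.GradedOp.comp_ofLinearMap_ofLinearMap] at this

/-- Powers of an algebraic endomorphism of `Hⁱ(X)` are algebraic, given that `g⁰ = id` is
(i.e. the Künneth projector `πⁱ`). [folklore] -/
theorem _root_.Literature.AlgebraicGeometry.Motives.PreWeilCohomology.IsAlgebraicOperator.pow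
    (hX : IsSmoothProjective nX X) {g : W.obj X i →ₗ[K] W.obj X i}
    (hg : W.IsAlgebraicOperator nX nX g)
    (hid : W.IsAlgebraicOperator nX nX (LinearMap.id : W.obj X i →ₗ[K] W.obj X i)) (m : ℕ) :
    W.IsAlgebraicOperator nX nX (g ^ m) := by
  induction m with
  | zero => rw [pow_zero]; exact hid
  | succ m ih =>
    rw [pow_succ]
    exact ih.comp hX hX hX hg

end Comp

end WeilCohomology

end Literature.AlgebraicGeometry.Motives

end
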